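import Literature.MathematicalPhysics.QuantumFieldTheory.Balaban1983to89.T3Thresholds

/-!
# Route `PoincareLipschitz` (planner ym-r3-idea-2 g7, LINE 15), glue `TwoSidedOfConcentration` (stmt-QuantumFields-23535) —
# helper 4: the SCALAR BUDGET of the height induction (`γ` small makes the local bad set rare)

In the height induction of the glue the complement of the local good set `G(a,j)` of a level-`j` plaquette is covered by the bad events
of the near plaquettes of the finer levels `i < j`: at most `V·L^{3(j−i)}` of them at level `i` (`V = 9·129³`), each of Gibbs mass
`≤ Cc·exp(−c₁·p(g_{K−i})²)` for `1 ≤ i` (induction hypothesis) and `≤ C₀·β_K⁵·exp(−c₀·p(g_K)²)` at the finest level `i = 0` (the tree's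
volume-uniform chessboard tail), where `g_h = √(γL^{−h})`, `β_K = g_K^{−2}`, `p(g) = b₀(1 + log g⁻¹)^{p₀}`.  THIS FILE: for `γ ≤ γ_A(L, b₀, p₀,
V, C₀, c₀, Cc, c₁)` the total is `≤ 1/4`, uniformly in `K` and `j ≤ K`.  Mechanism: with `x_h = log g_h⁻¹ ≥ ½·log γ⁻¹`, every polynomial
prefactor is `≤ e^{16 x_h}` while `p(g_h)² ≥ b₀²x_h²`, so each term is `≤ const·e^{−2x_h} = const·γ·L^{−h}` once `x_h ≥ 18/(b₀² min(c₀,c₁)) + 1`,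
and `Σ_{h ≥ 1} L^{−h} ≤ 1`.

Width seat ym-line-sfw-p2-w3 g30 (cell ym-idea-1, R3 family; free hands), `--supports stmt-QuantumFields-23535`.  Elementary real analysis; no crux,
rung (R3 is a RECORD rung) or summit is proved; the Yang–Mills mass gap is NOT proved.
-/

set_option autoImplicit false

namespace Summit.QuantumFields.YangMills.Theorems.PoincareLipschitz.TwoSidedOfConcentration

open scoped BigOperators
open Literature.MathematicalPhysics.QuantumFieldTheory.Balaban1983to89

/-! ## §1 The effective coupling `g_h = √(γL^{−h})` and its logarithm -/

/-- `0 < g_h`, `g_h ≤ 1`, `g_h² = γL^{−h} ≤ γ` for `0 < γ ≤ 1`, `L ≥ 1`. [cite: Balaban1985UV3, (3) p.256] -/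
theorem coupling_basic {L : ℕ} (hL : 1 ≤ L) {γ : ℝ} (hγ : 0 < γ) (hγ1 : γ ≤ 1) (h : ℕ) :
    0 < Real.sqrt (γ * ((L : ℝ)⁻¹) ^ h) ∧ Real.sqrt (γ * ((L : ℝ)⁻¹) ^ h) ≤ 1 ∧
      Real.sqrt (γ * ((L : ℝ)⁻¹) ^ h) ^ 2 = γ * ((L : ℝ)⁻¹) ^ h ∧ γ * ((L : ℝ)⁻¹) ^ h ≤ γ := by
  have hL' : (1 : ℝ) ≤ L := by exact_mod_cast hL
  have hLi : 0 < ((L : ℝ)⁻¹) ^ h := pow_pos (inv_pos.mpr (by linarith)) h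
  have hLi1 : ((L : ℝ)⁻¹) ^ h ≤ 1 := pow_le_one₀ (inv_nonneg.mpr (by linarith)) (inv_le_one_of_one_le₀ hL')
  have hx : 0 < γ * ((L : ℝ)⁻¹) ^ h := mul_pos hγ hLi
  have hxγ : γ * ((L : ℝ)⁻¹) ^ h ≤ γ := mul_le_of_le_one_right hγ.le hLi1
  refine ⟨Real.sqrt_pos.mpr hx, Real.sqrt_le_one.mpr (hxγ.trans hγ1), Real.sq_sqrt hx.le, hxγ⟩

/-- `x_h = log g_h⁻¹ ≥ X` as soon as `γ ≤ e^{−2X}` (`g_h² ≤ γ`). [folklore] -/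
theorem log_inv_coupling_ge {L : ℕ} (hL : 1 ≤ L) {γ X : ℝ} (hγ : 0 < γ) (hγ1 : γ ≤ 1) (hγX : γ ≤ Real.exp (-(2 * X))) (h : ℕ) :
    X ≤ Real.log (Real.sqrt (γ * ((L : ℝ)⁻¹) ^ h))⁻¹ := by
  obtain ⟨hg, _, hg2, hle⟩ := coupling_basic hL hγ hγ1 h
  set g := Real.sqrt (γ * ((L : ℝ)⁻¹) ^ h) with hgdef
  have h2 : g ^ 2 ≤ Real.exp (-(2 * X)) := by rw [hg2]; exact hle.trans hγX
  -- `2 log g ≤ -2X`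
  have hlog : Real.log (g ^ 2) ≤ -(2 * X) := by
    have := Real.log_le_log (pow_pos hg 2) h2
    rwa [Real.log_exp] at this
  rw [Real.log_pow] at hlog
  rw [Real.log_inv]
  push_cast at hlog
  linarith

/-- `L^{3h} ≤ e^{6 x_h}` (`L^h = γ/g_h² ≤ g_h^{−2} = e^{2x_h}` for `γ ≤ 1`). [folklore] -/
theorem pow_cube_le_exp {L : ℕ} (hL : 1 ≤ L) {γ : ℝ} (hγ : 0 < γ) (hγ1 : γ ≤ 1) (h : ℕ) :
    ((L : ℝ) ^ h) ^ 3 ≤ Real.exp (6 * Real.log (Real.sqrt (γ * ((L : ℝ)⁻¹) ^ h))⁻¹) := by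
  obtain ⟨hg, _, hg2, _⟩ := coupling_basic hL hγ hγ1 h
  set g := Real.sqrt (γ * ((L : ℝ)⁻¹) ^ h) with hgdef
  have hL0 : (0 : ℝ) < (L : ℝ) ^ h := pow_pos (by exact_mod_cast (lt_of_lt_of_le zero_lt_one hL)) h
  -- `L^h = γ / g²`
  have hLh : (L : ℝ) ^ h = γ / g ^ 2 := by
    rw [hg2, inv_pow]
    field_simp
  have hLh_le : (L : ℝ) ^ h ≤ (g ^ 2)⁻¹ := by
    rw [hLh, div_eq_mul_inv]
    exact mul_le_of_le_one_left (inv_nonneg.mpr (sq_nonneg _)) hγ1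
  have hexp : (g ^ 2)⁻¹ = Real.exp (2 * Real.log g⁻¹) := by
    rw [B10.sq_eq_exp_log g hg, ← Real.exp_neg, neg_neg]
  calc ((L : ℝ) ^ h) ^ 3 ≤ ((g ^ 2)⁻¹) ^ 3 := by gcongr
    _ = Real.exp (6 * Real.log g⁻¹) := by
        rw [hexp, ← Real.exp_nat_mul]
        congr 1
        push_cast
        ring

/-- `g_h^{−2} = e^{2 x_h}`, i.e. `(γL^{−h})⁻¹ = e^{2x_h}`. [folklore] -/
theorem inv_coupling_sq_eq_exp {L : ℕ} (hL : 1 ≤ L) {γ : ℝ} (hγ : 0 < γ) (hγ1 : γ ≤ 1) (h : ℕ) :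
    (γ * ((L : ℝ)⁻¹) ^ h)⁻¹ = Real.exp (2 * Real.log (Real.sqrt (γ * ((L : ℝ)⁻¹) ^ h))⁻¹) := by
  obtain ⟨hg, _, hg2, _⟩ := coupling_basic hL hγ hγ1 h
  set g := Real.sqrt (γ * ((L : ℝ)⁻¹) ^ h) with hgdef
  rw [← hg2, B10.sq_eq_exp_log _ hg, ← Real.exp_neg, neg_neg]

/-- `p(g)² ≥ b₀²·(log g⁻¹)²` on `(0,1]` for `p₀ ≥ 1` (`(1+x)^{p₀} ≥ 1 + x ≥ x`). [cite: Balaban1985UV3, (7) p.257] -/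
theorem sq_log_le_pFun_sq {b₀ p₀ g : ℝ} (hp₀ : 1 ≤ p₀) (hg : 0 < g) (hg1 : g ≤ 1) :
    b₀ ^ 2 * Real.log g⁻¹ ^ 2 ≤ B10.pFun b₀ p₀ g ^ 2 := by
  have hx : 0 ≤ Real.log g⁻¹ := B10.log_inv_nonneg_of_le_one hg hg1
  set x := Real.log g⁻¹ with hxdef
  have h1 : 1 + x ≤ (1 + x) ^ p₀ := by
    have := Real.rpow_le_rpow_of_exponent_le (by linarith : (1 : ℝ) ≤ 1 + x) hp₀
    rwa [Real.rpow_one] at this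
  have h2 : x ≤ (1 + x) ^ p₀ := by linarith
  unfold B10.pFun
  rw [← hxdef, mul_pow]
  exact mul_le_mul_of_nonneg_left (pow_le_pow_left₀ hx h2 2) (sq_nonneg _)

/-! ## §2 The geometric sum over the finer levels -/

/-- `Σ_{1 ≤ i < j} L^{−(K−i)} ≤ L^{−(K−j+1)}/(1 − L⁻¹)` for `j ≤ K` (`L ≥ 2`). [folklore] -/
theorem sum_Ico_inv_pow_le {L : ℕ} (hL : 2 ≤ L) (K : ℕ) :
    ∀ j : ℕ, j ≤ K → ∑ i ∈ Finset.Ico 1 j, ((L : ℝ)⁻¹) ^ (K - i) ≤ ((L : ℝ)⁻¹) ^ (K - j + 1) / (1 - (L : ℝ)⁻¹) := by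
  have hL' : (2 : ℝ) ≤ L := by exact_mod_cast hL
  have hr0 : 0 ≤ (L : ℝ)⁻¹ := inv_nonneg.mpr (by linarith)
  have hr1 : (L : ℝ)⁻¹ ≤ 1 / 2 := by rw [one_div]; exact inv_anti₀ two_pos hL'
  have h1r : 0 < 1 - (L : ℝ)⁻¹ := by linarith
  intro j
  induction j with
  | zero => intro _; rw [Finset.Ico_eq_empty_of_le (by norm_num), Finset.sum_empty]; positivity
  | succ j ih =>
    intro hjK
    rcases Nat.eq_zero_or_pos j with hj0 | hj0
    · subst hj0
      simp only [zero_add, Finset.Ico_self, Finset.sum_empty]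
      positivity
    · rw [Finset.sum_Ico_succ_top hj0]
      have hih := ih (by omega)
      have hKj : K - j = K - (j + 1) + 1 := by omega
      calc ∑ i ∈ Finset.Ico 1 j, ((L : ℝ)⁻¹) ^ (K - i) + ((L : ℝ)⁻¹) ^ (K - j)
          ≤ ((L : ℝ)⁻¹) ^ (K - j + 1) / (1 - (L : ℝ)⁻¹) + ((L : ℝ)⁻¹) ^ (K - j) := by linarith
        _ = ((L : ℝ)⁻¹) ^ (K - j) / (1 - (L : ℝ)⁻¹) := by
            rw [eq_div_iff h1r.ne', add_mul, div_mul_cancel₀ _ h1r.ne', pow_succ]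
            ring
        _ = ((L : ℝ)⁻¹) ^ (K - (j + 1) + 1) / (1 - (L : ℝ)⁻¹) := by rw [hKj]

/-- `Σ_{1 ≤ i < j} L^{−(K−i)} ≤ 1` for `j ≤ K`, `L ≥ 2`. [folklore] -/
theorem sum_Ico_inv_pow_le_one {L : ℕ} (hL : 2 ≤ L) {K j : ℕ} (hjK : j ≤ K) :
    ∑ i ∈ Finset.Ico 1 j, ((L : ℝ)⁻¹) ^ (K - i) ≤ 1 := by
  have hL' : (2 : ℝ) ≤ L := by exact_mod_cast hL
  have hr0 : 0 ≤ (L : ℝ)⁻¹ := inv_nonneg.mpr (by linarith)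
  have hr1 : (L : ℝ)⁻¹ ≤ 1 / 2 := by rw [one_div]; exact inv_anti₀ two_pos hL'
  have h1r : 0 < 1 - (L : ℝ)⁻¹ := by linarith
  refine (sum_Ico_inv_pow_le hL K j hjK).trans ?_
  rw [div_le_one h1r]
  have hp : ((L : ℝ)⁻¹) ^ (K - j + 1) ≤ (L : ℝ)⁻¹ := by
    rw [pow_succ]
    exact mul_le_of_le_one_left hr0 (pow_le_one₀ hr0 (by linarith))
  linarith

/-! ## §3 The budget -/

/-- **THE SCALAR BUDGET OF THE HEIGHT INDUCTION.**  For `L ≥ 2`, `b₀ > 0`, `p₀ ≥ 1` and constants `V, C₀, Cc ≥ 0`, `c₀, c₁ > 0` there is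
`γ_A ∈ (0, 1]` such that for all `0 < γ ≤ γ_A`, all `K` and all `j ≤ K`:
`V·L^{3j}·C₀·β_K⁵·e^{−c₀ p(g_K)²} + Σ_{1 ≤ i < j} V·L^{3(j−i)}·Cc·e^{−c₁ p(g_{K−i})²} ≤ 1/4`
(`g_h = √(γL^{−h})`, `β_K = (γL^{−K})⁻¹`).  Each term is `≤ const·γ·L^{−h}` for `γ ≤ e^{−2X}`, `X = 18/(b₀² min(c₀,c₁)) + 1`. [folklore] -/
theorem localGood_budget {L : ℕ} (hL : 2 ≤ L) {b₀ p₀ V C₀ c₀ Cc c₁ : ℝ} (hb₀ : 0 < b₀) (hp₀ : 1 ≤ p₀) (hV : 0 ≤ V)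
    (hC₀ : 0 ≤ C₀) (hc₀ : 0 < c₀) (hCc : 0 ≤ Cc) (hc₁ : 0 < c₁) :
    ∃ γA : ℝ, 0 < γA ∧ γA ≤ 1 ∧ ∀ γ : ℝ, 0 < γ → γ ≤ γA → ∀ K j : ℕ, j ≤ K →
      V * ((L : ℝ) ^ j) ^ 3 * (C₀ * ((γ * ((L : ℝ)⁻¹) ^ K)⁻¹) ^ 5 *
          Real.exp (-(c₀ * B10.pFun b₀ p₀ (Real.sqrt (γ * ((L : ℝ)⁻¹) ^ K)) ^ 2))) +
        ∑ i ∈ Finset.Ico 1 j, V * ((L : ℝ) ^ (j - i)) ^ 3 *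
          (Cc * Real.exp (-(c₁ * B10.pFun b₀ p₀ (Real.sqrt (γ * ((L : ℝ)⁻¹) ^ (K - i))) ^ 2))) ≤ 1 / 4 := by
  have hL1 : 1 ≤ L := by omega
  have hL' : (1 : ℝ) ≤ L := by exact_mod_cast hL1
  -- the quadratic rate
  set c : ℝ := min c₀ c₁ * b₀ ^ 2 with hc
  have hcpos : 0 < c := mul_pos (lt_min hc₀ hc₁) (pow_pos hb₀ 2)
  set X : ℝ := 18 / c + 1 with hX
  have hX0 : 0 ≤ X := by positivity
  -- the threshold
  set D : ℝ := V * (C₀ + Cc) + 1 with hD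
  have hD0 : 0 < D := by positivity
  refine ⟨min 1 (min (Real.exp (-(2 * X))) (1 / (4 * D))), by positivity,
    min_le_left _ _, fun γ hγ hγA K j hjK => ?_⟩
  have hγ1 : γ ≤ 1 := hγA.trans (min_le_left _ _)
  have hγX : γ ≤ Real.exp (-(2 * X)) := hγA.trans ((min_le_right _ _).trans (min_le_left _ _))
  have hγD : γ ≤ 1 / (4 * D) := hγA.trans ((min_le_right _ _).trans (min_le_right _ _))
  -- the key pointwise estimate at height `h`: polynomial prefactor `e^{16x}` against `e^{-c x²}`
  have key : ∀ h : ℕ, ∀ A : ℝ, A ≤ 16 →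
      Real.exp (A * Real.log (Real.sqrt (γ * ((L : ℝ)⁻¹) ^ h))⁻¹) *
          Real.exp (-(c * Real.log (Real.sqrt (γ * ((L : ℝ)⁻¹) ^ h))⁻¹ ^ 2)) ≤ γ * ((L : ℝ)⁻¹) ^ h := by
    intro h A hA
    obtain ⟨hg, hg1, hg2, _⟩ := coupling_basic hL1 hγ hγ1 h
    have hx := log_inv_coupling_ge hL1 hγ hγ1 hγX h
    set x := Real.log (Real.sqrt (γ * ((L : ℝ)⁻¹) ^ h))⁻¹ with hxdef
    have hx0 : 0 ≤ x := hX0.trans hx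
    -- `c x² ≥ 18 x` since `x ≥ 18/c + 1`
    have hquad : 18 * x ≤ c * x ^ 2 := by
      have h1 : 18 ≤ c * X := by
        rw [hX, mul_add, mul_div_cancel₀ _ hcpos.ne']
        linarith [hcpos]
      have h2 : c * X ≤ c * x := mul_le_mul_of_nonneg_left hx hcpos.le
      nlinarith
    rw [← Real.exp_add, ← hg2, B10.sq_eq_exp_log _ hg, ← hxdef]
    exact Real.exp_le_exp.mpr (by nlinarith)
  -- `p(g_h)² ≥ b₀² x_h²`, hence `e^{-cᵢ p²} ≤ e^{-c x²}`
  have hrate : ∀ h : ℕ, ∀ c' : ℝ, min c₀ c₁ ≤ c' →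
      Real.exp (-(c' * B10.pFun b₀ p₀ (Real.sqrt (γ * ((L : ℝ)⁻¹) ^ h)) ^ 2)) ≤
        Real.exp (-(c * Real.log (Real.sqrt (γ * ((L : ℝ)⁻¹) ^ h))⁻¹ ^ 2)) := by
    intro h c' hc'
    obtain ⟨hg, hg1, _, _⟩ := coupling_basic hL1 hγ hγ1 h
    have hp := sq_log_le_pFun_sq (b₀ := b₀) hp₀ hg hg1
    have hmin0 : 0 ≤ min c₀ c₁ := (lt_min hc₀ hc₁).le
    refine Real.exp_le_exp.mpr (neg_le_neg ?_)
    calc c * Real.log (Real.sqrt (γ * ((L : ℝ)⁻¹) ^ h))⁻¹ ^ 2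
        = min c₀ c₁ * (b₀ ^ 2 * Real.log (Real.sqrt (γ * ((L : ℝ)⁻¹) ^ h))⁻¹ ^ 2) := by rw [hc]; ring
      _ ≤ min c₀ c₁ * B10.pFun b₀ p₀ (Real.sqrt (γ * ((L : ℝ)⁻¹) ^ h)) ^ 2 := mul_le_mul_of_nonneg_left hp hmin0
      _ ≤ c' * B10.pFun b₀ p₀ (Real.sqrt (γ * ((L : ℝ)⁻¹) ^ h)) ^ 2 := mul_le_mul_of_nonneg_right hc' (sq_nonneg _)
  -- level-0 term `≤ V C₀ γ`
  have hT0 : V * ((L : ℝ) ^ j) ^ 3 * (C₀ * ((γ * ((L : ℝ)⁻¹) ^ K)⁻¹) ^ 5 *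
      Real.exp (-(c₀ * B10.pFun b₀ p₀ (Real.sqrt (γ * ((L : ℝ)⁻¹) ^ K)) ^ 2))) ≤ V * C₀ * γ := by
    set x := Real.log (Real.sqrt (γ * ((L : ℝ)⁻¹) ^ K))⁻¹ with hxdef
    have hLj : ((L : ℝ) ^ j) ^ 3 ≤ ((L : ℝ) ^ K) ^ 3 :=
      pow_le_pow_left₀ (by positivity) (pow_le_pow_right₀ hL' hjK) 3
    have hLK : ((L : ℝ) ^ K) ^ 3 ≤ Real.exp (6 * x) := pow_cube_le_exp hL1 hγ hγ1 K
    have hβ : ((γ * ((L : ℝ)⁻¹) ^ K)⁻¹) ^ 5 = Real.exp (10 * x) := by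
      rw [inv_coupling_sq_eq_exp hL1 hγ hγ1 K, ← hxdef, ← Real.exp_nat_mul]; ring_nf
    have hE := hrate K c₀ (min_le_left _ _)
    have hk := key K 16 le_rfl
    have hLK' : γ * ((L : ℝ)⁻¹) ^ K ≤ γ := (coupling_basic hL1 hγ hγ1 K).2.2.2
    have hL3 : ((L : ℝ) ^ j) ^ 3 ≤ Real.exp (6 * x) := hLj.trans hLK
    calc V * ((L : ℝ) ^ j) ^ 3 * (C₀ * ((γ * ((L : ℝ)⁻¹) ^ K)⁻¹) ^ 5 *
          Real.exp (-(c₀ * B10.pFun b₀ p₀ (Real.sqrt (γ * ((L : ℝ)⁻¹) ^ K)) ^ 2)))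
        ≤ V * Real.exp (6 * x) * (C₀ * Real.exp (10 * x) * Real.exp (-(c * x ^ 2))) := by
          rw [hβ]
          gcongr
      _ = V * C₀ * (Real.exp (16 * x) * Real.exp (-(c * x ^ 2))) := by
          have : Real.exp (16 * x) = Real.exp (6 * x) * Real.exp (10 * x) := by rw [← Real.exp_add]; ring_nf
          rw [this]; ring
      _ ≤ V * C₀ * (γ * ((L : ℝ)⁻¹) ^ K) := by gcongr
      _ ≤ V * C₀ * γ := by gcongr
  -- level-`i` terms `≤ V Cc γ L^{-(K-i)}`
  have hTi : ∀ i ∈ Finset.Ico 1 j, V * ((L : ℝ) ^ (j - i)) ^ 3 *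
      (Cc * Real.exp (-(c₁ * B10.pFun b₀ p₀ (Real.sqrt (γ * ((L : ℝ)⁻¹) ^ (K - i))) ^ 2))) ≤
        V * Cc * (γ * ((L : ℝ)⁻¹) ^ (K - i)) := by
    intro i hi
    rw [Finset.mem_Ico] at hi
    set x := Real.log (Real.sqrt (γ * ((L : ℝ)⁻¹) ^ (K - i)))⁻¹ with hxdef
    have hLj : ((L : ℝ) ^ (j - i)) ^ 3 ≤ ((L : ℝ) ^ (K - i)) ^ 3 :=
      pow_le_pow_left₀ (by positivity) (pow_le_pow_right₀ hL' (by omega)) 3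
    have hLK : ((L : ℝ) ^ (K - i)) ^ 3 ≤ Real.exp (6 * x) := pow_cube_le_exp hL1 hγ hγ1 (K - i)
    have hE := hrate (K - i) c₁ (min_le_right _ _)
    have hk := key (K - i) 6 (by norm_num)
    have hL3 : ((L : ℝ) ^ (j - i)) ^ 3 ≤ Real.exp (6 * x) := hLj.trans hLK
    calc V * ((L : ℝ) ^ (j - i)) ^ 3 * (Cc * Real.exp (-(c₁ * B10.pFun b₀ p₀ (Real.sqrt (γ * ((L : ℝ)⁻¹) ^ (K - i))) ^ 2)))
        ≤ V * Real.exp (6 * x) * (Cc * Real.exp (-(c * x ^ 2))) := by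
          gcongr
      _ = V * Cc * (Real.exp (6 * x) * Real.exp (-(c * x ^ 2))) := by ring
      _ ≤ V * Cc * (γ * ((L : ℝ)⁻¹) ^ (K - i)) := by gcongr
  -- sum up
  have hsum : ∑ i ∈ Finset.Ico 1 j, V * ((L : ℝ) ^ (j - i)) ^ 3 *
      (Cc * Real.exp (-(c₁ * B10.pFun b₀ p₀ (Real.sqrt (γ * ((L : ℝ)⁻¹) ^ (K - i))) ^ 2))) ≤ V * Cc * γ := by
    calc ∑ i ∈ Finset.Ico 1 j, V * ((L : ℝ) ^ (j - i)) ^ 3 *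
          (Cc * Real.exp (-(c₁ * B10.pFun b₀ p₀ (Real.sqrt (γ * ((L : ℝ)⁻¹) ^ (K - i))) ^ 2)))
        ≤ ∑ i ∈ Finset.Ico 1 j, V * Cc * (γ * ((L : ℝ)⁻¹) ^ (K - i)) := Finset.sum_le_sum hTi
      _ = V * Cc * γ * ∑ i ∈ Finset.Ico 1 j, ((L : ℝ)⁻¹) ^ (K - i) := by rw [Finset.mul_sum]; ring_nf
      _ ≤ V * Cc * γ * 1 := by gcongr; exact sum_Ico_inv_pow_le_one hL hjK
      _ = V * Cc * γ := mul_one _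
  -- conclude
  have hfin : V * C₀ * γ + V * Cc * γ ≤ 1 / 4 := by
    have h1 : V * C₀ * γ + V * Cc * γ = V * (C₀ + Cc) * γ := by ring
    rw [h1]
    have h2 : V * (C₀ + Cc) ≤ D := by rw [hD]; linarith
    have h3 : V * (C₀ + Cc) * γ ≤ D * γ := mul_le_mul_of_nonneg_right h2 hγ.le
    have h4 : D * γ ≤ D * (1 / (4 * D)) := mul_le_mul_of_nonneg_left hγD hD0.le
    have h5 : D * (1 / (4 * D)) = 1 / 4 := by field_simp
    linarith
  linarith [hT0, hsum]

end Summit.QuantumFields.YangMills.Theorems.PoincareLipschitz.TwoSidedOfConcentration
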